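import Summits.ResolutionOfSingularities.ResolutionOfSingularities.Theorems.UniversalCellsCampaignW82OneField
import Summits.ResolutionOfSingularities.ResolutionOfSingularities.Theorems.UniversalCellsCampaignW82PrimeFieldTransferLinks
import Mathlib.FieldTheory.PerfectClosure
import Mathlib.FieldTheory.IsPerfectClosure
import HarnessLib

/-!
# [OURS · L1 W8.2] Links: crux `PrimeFieldToPerfect` (stmt-15233) is ONE implication `Res(𝔽_p) ⇒ Res(Ω₁(p))` per
# prime, `Ω₁(p) = (𝔽_p(x₀, x₁, …))^{perf}`

Cell `res-hironaka` (run/shared/lean/pub/res-hironaka/), LADDER-RESOLUTION rung L (RESCUE), slot W8.2; host route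
`UniversalCells`, host item `PrimeFieldToPerfect` (stmt-ResolutionOfSingularities-15233), door 1. By-name leaf
(imports the Theses cone through `…PrimeFieldTransferLinks`), written by res-L1-s82-pv-1 (gen 4), for
`…OneField.lean`.

* `primeFieldTransferAt_iff_oneField` — for `Ω` perfect purely inseparable over `Frac 𝔽_p[x_n : n ∈ ℕ]`:
  `PrimeFieldTransferAt p ↔ (Res(ZMod p) ⇒ Res(Ω))` (integral separated schemes of finite type);
* `primeFieldToPerfect_iff_oneField` — the crux `Theses.UniversalCells.PrimeFieldToPerfect` is equivalent to:
  for every prime `p` and every (equivalently one, e.g. `PerfectClosure (FractionRing (MvPolynomial ℕ (ZMod p))) p`)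
  perfect `Ω` purely inseparable over `Frac 𝔽_p[x_ℕ]`, `Res(ZMod p)` implies resolution over `Ω`. Door 1 of slot W8.2, like door 2
  (`PrimeModelTransfer.primeModelTransfer_iff_oneField`, res-L1-s82-pv-2), is one implication between the prime field
  and ONE countable field per prime.

HONEST FRAMING. OURS theorems about OURS statements (role replaced: §17 ¶2 p.89 l.59–62 of [Hironaka2017], typed AS
PRINTED as `S17Methodology.U89_3`); NOT statements of the manuscript; nothing attributed to its author; no typed
candidate used. A normal form of the crux, not progress on it. AI work, weaker than expert review.
-/

noncomputable section

set_option linter.dupNamespace false -- mandated namespace of this single-conjunct summit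

open CategoryTheory CategoryTheory.Limits AlgebraicGeometry TopologicalSpace
open Literature.AlgebraicGeometry.Resolution

namespace Summit.ResolutionOfSingularities.ResolutionOfSingularities.Theorems.CampaignW82

/-- **The `p`-slice of the crux is `Res(ZMod p) ⇒ Res(Ω)` for ANY perfect `Ω` purely inseparable over
`Frac 𝔽_p[x_n : n ∈ ℕ]`** («⇒»: `Ω` is a perfect field of characteristic `p` and integral schemes are reduced;
«⇐»: `reducedRes_of_primeField_of_oneField`). [folklore] -/
theorem primeFieldTransferAt_iff_oneField (p : ℕ) [hp : Fact p.Prime] (Ω : Type) [Field Ω] [PerfectField Ω]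
    [Algebra (FractionRing (MvPolynomial ℕ (ZMod p))) Ω]
    [IsPurelyInseparable (FractionRing (MvPolynomial ℕ (ZMod p))) Ω] :
    PrimeFieldTransferAt p ↔
      ((∀ (X : Scheme.{0}) (f : X ⟶ Spec (.of (ZMod p))), IsSeparated f → LocallyOfFiniteType f →
          QuasiCompact f → IsIntegral X → Scheme.HasResolution X) →
        ∀ (X : Scheme.{0}) (f : X ⟶ Spec (.of Ω)), IsSeparated f → LocallyOfFiniteType f →
          QuasiCompact f → IsIntegral X → Scheme.HasResolution X) := by
  haveI : CharP (FractionRing (MvPolynomial ℕ (ZMod p))) p :=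
    charP_of_injective_algebraMap (IsFractionRing.injective (MvPolynomial ℕ (ZMod p)) _) p
  haveI : CharP Ω p :=
    charP_of_injective_algebraMap (algebraMap (FractionRing (MvPolynomial ℕ (ZMod p))) Ω).injective p
  constructor
  · intro h h₀ X f hs hl hq hX
    haveI := hX
    exact h h₀ Ω X f hs hl hq inferInstance
  · intro h h₀ k _ _ _ X f hs hl hq hr
    exact reducedRes_of_primeField_of_oneField p hp.out h₀ Ω (h h₀) k X f hs hl hq hr

/-- **ONE FIELD SUFFICES FOR DOOR 1**: the crux `Theses.UniversalCells.PrimeFieldToPerfect`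
(stmt-ResolutionOfSingularities-15233) holds iff for every prime `p` and every (equivalently: one) perfect field
`Ω` purely inseparable over `Frac 𝔽_p[x_n : n ∈ ℕ]` — all such `Ω` are isomorphic to the ONE countable perfect field
`(𝔽_p(x₀, x₁, …))^{perf}`, e.g. Mathlib's `PerfectClosure (FractionRing (MvPolynomial ℕ (ZMod p))) p` with structure
map `PerfectClosure.of` — resolution of all integral separated schemes of finite type over `ZMod p` implies the same
over `Ω`. [folklore] -/
theorem primeFieldToPerfect_iff_oneField :
    Summit.ResolutionOfSingularities.ResolutionOfSingularities.Theses.UniversalCells.PrimeFieldToPerfect ↔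
      ∀ (p : ℕ), p.Prime → ∀ (Ω : Type) [Field Ω] [PerfectField Ω]
        [Algebra (FractionRing (MvPolynomial ℕ (ZMod p))) Ω]
        [IsPurelyInseparable (FractionRing (MvPolynomial ℕ (ZMod p))) Ω],
        (∀ (X : Scheme.{0}) (f : X ⟶ Spec (.of (ZMod p))), IsSeparated f → LocallyOfFiniteType f →
            QuasiCompact f → IsIntegral X → Scheme.HasResolution X) →
          ∀ (X : Scheme.{0}) (f : X ⟶ Spec (.of Ω)), IsSeparated f → LocallyOfFiniteType f →
            QuasiCompact f → IsIntegral X → Scheme.HasResolution X := by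
  rw [primeFieldToPerfect_iff]
  refine forall_congr' fun p => forall_congr' fun hp => ?_
  haveI : Fact p.Prime := ⟨hp⟩
  constructor
  · intro h Ω _ _ _ _
    exact (primeFieldTransferAt_iff_oneField p Ω).1 h
  · intro h
    letI : Algebra (FractionRing (MvPolynomial ℕ (ZMod p))) (PerfectClosure (FractionRing (MvPolynomial ℕ (ZMod p))) p) :=
      (PerfectClosure.of (FractionRing (MvPolynomial ℕ (ZMod p))) p).toAlgebra
    haveI : CharP (FractionRing (MvPolynomial ℕ (ZMod p))) p :=
      charP_of_injective_algebraMap (IsFractionRing.injective (MvPolynomial ℕ (ZMod p)) _) p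
    haveI : ExpChar (FractionRing (MvPolynomial ℕ (ZMod p))) p := ExpChar.prime hp
    haveI : IsPRadical (algebraMap (FractionRing (MvPolynomial ℕ (ZMod p)))
        (PerfectClosure (FractionRing (MvPolynomial ℕ (ZMod p))) p)) p :=
      PerfectClosure.isPRadical (FractionRing (MvPolynomial ℕ (ZMod p))) p
    haveI : IsPurelyInseparable (FractionRing (MvPolynomial ℕ (ZMod p)))
        (PerfectClosure (FractionRing (MvPolynomial ℕ (ZMod p))) p) :=
      IsPRadical.isPurelyInseparable (FractionRing (MvPolynomial ℕ (ZMod p)))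
        (PerfectClosure (FractionRing (MvPolynomial ℕ (ZMod p))) p) p
    exact (primeFieldTransferAt_iff_oneField p (PerfectClosure (FractionRing (MvPolynomial ℕ (ZMod p))) p)).2
      (h _)


/-! ## v2 (append-only): resolution over ALL perfect fields of characteristic `p` is decided on TWO countable fields

Everything above this line is byte-identical with v1 (p529749). Appended by res-L1-s82-pv-1 (gen 4). -/

/-- **`PerfectRes p` — resolution of reduced separated schemes of finite type over EVERY perfect field of
characteristic `p` (rung-B vocabulary, `Theorems/HironakaBridge.lean`) — is equivalent to resolution over the TWO
countable fields `ZMod p` (`PrimeFieldRes p`) and `Ω ≅ (𝔽_p(x₀, x₁, …))^{perf}`** (any perfect `Ω` purely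
inseparable over `Frac 𝔽_p[x_n : n ∈ ℕ]`). «→»: both are perfect fields of characteristic `p`; «←»:
`reducedRes_of_primeField_of_oneField` (an integral scheme is reduced). [folklore] -/
theorem perfectRes_iff_primeField_and_oneField (p : ℕ) [hp : Fact p.Prime] (Ω : Type) [Field Ω] [PerfectField Ω]
    [Algebra (FractionRing (MvPolynomial ℕ (ZMod p))) Ω]
    [IsPurelyInseparable (FractionRing (MvPolynomial ℕ (ZMod p))) Ω] :
    Summit.ResolutionOfSingularities.ResolutionOfSingularities.Theorems.PerfectRes p ↔
      Summit.ResolutionOfSingularities.ResolutionOfSingularities.Theorems.PrimeFieldRes p ∧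
        ∀ (X : Scheme.{0}) (f : X ⟶ Spec (.of Ω)), IsSeparated f → LocallyOfFiniteType f →
          QuasiCompact f → IsReduced X → Scheme.HasResolution X := by
  haveI : CharP (FractionRing (MvPolynomial ℕ (ZMod p))) p :=
    charP_of_injective_algebraMap (IsFractionRing.injective (MvPolynomial ℕ (ZMod p)) _) p
  haveI : CharP Ω p :=
    charP_of_injective_algebraMap (algebraMap (FractionRing (MvPolynomial ℕ (ZMod p))) Ω).injective p
  constructor
  · intro h
    exact ⟨fun X f hs hl hq hr => h (ZMod p) X f hs hl hq hr, fun X f hs hl hq hr => h Ω X f hs hl hq hr⟩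
  · rintro ⟨h₀, hΩ⟩ k _ _ _ X f hs hl hq hr
    exact reducedRes_of_primeField_of_oneField p hp.out
      (fun Y g hs' hl' hq' hY => h₀ Y g hs' hl' hq' (by haveI := hY; infer_instance)) Ω
      (fun Y g hs' hl' hq' hY => hΩ Y g hs' hl' hq' (by haveI := hY; infer_instance)) k X f hs hl hq hr

end Summit.ResolutionOfSingularities.ResolutionOfSingularities.Theorems.CampaignW82

end
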